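import Literature.NumberTheory.Sieve.LevelOfDistribution
import HarnessLib

/-!
# Maynard 2020/2025, *Primes in arithmetic progressions to large moduli I*, Corollary 1.2:
# primes in progressions to moduli beyond `x^{1/2}` having a conveniently sized factor (fixed residue)

Trunk `Literature/NumberTheory/Sieve`, companion to `Literature.NumberTheory.Sieve.LevelOfDistribution`
(`primeCountingMod q a x = π(x; q, a)`) and `BombieriFriedlanderIwaniec.lean` (BFI Theorem 10, the
well-factorable fixed-residue estimate, whose `π`-form statement shape is reused here).

J. Maynard, *Primes in arithmetic progressions to large moduli I: General moduli*, Mem. Amer. Math. Soc.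
**1542** (2025) = arXiv:2006.06572, §1 (read: arXiv text, §1 through §1.1):

* Theorem 1.1 (NOT vendored): for `a ∈ ℤ`, `ε > 0`, `Q₁ Q₂² < x^{1−100ε}`, `Q₁^{12} Q₂^7 < x^{4−100ε}`,
  `Q₁^{20} Q₂^{19} < x^{10−100ε}` and every `A > 0`,
  `∑_{q₁ ≤ Q₁, (q₁,a)=1} ∑_{q₂ ≤ Q₂, (q₂,a)=1} |π(x; q₁q₂, a) − π(x)/φ(q₁q₂)| ≪_{a,ε,A} x/(log x)^A`;
* **Corollary 1.2** (VENDORED as the named fact `MaynardLargeModuliFactorable`): "Let `a ∈ ℤ`,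
  `0 < δ < 1/42`, and `0 < η < (1 − 42δ)/4` and
  `𝒬_{δ,η} := {q ≤ x^{1/2+δ} : ∃ d ∣ q s.t. x^{2δ+η} < d < min(x^{1/10}/x^{7δ/5+η}, x^{1/2}/x^{19δ+η})}`.
  Then for every `A > 0` we have `∑_{q ∈ 𝒬_{δ,η}, (q,a)=1} |π(x; q, a) − π(x)/φ(q)| ≪_{a,η,A} x/(log x)^A`."
  ("Theorem 1.1 can be rephrased as follows", setting `Q₁Q₂ = x^{1/2+δ}`);
* Corollary 1.3 (NOT vendored): for `0 < δ < 1/55`, `Q ≤ x^{1/2+δ}`, all but at most `18δQφ(a)/a` moduli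
  `q ∈ [Q, 2Q]` with `(q, a) = 1` satisfy `π(x; q, a) = (1 + O_{a,δ,A}((log x)^{−A})) π(x)/φ(q)`.

## Contents

* `MaynardLargeModuliFactorable` — Corollary 1.2 as printed (the `π`-form; absolute values; fixed residue
  class `a ∈ ℤ`, read modulo `q` through `(a : ZMod q).val`; the implied constant is allowed to depend on
  `a, δ, η, A` — the print lists `a, η, A`), a named FACT `def … : Prop` (a deep theorem: amplification +
  dispersion + Kuznetsov / Deligne bounds; Chapters 6–21 of the source; not in Mathlib, no `_holds`).
* `MaynardLargeModuliFactorable.bound_nonneg` — cosmetic normalisation `C ≥ 0`, `x₀ ≥ 2`.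
* `MaynardLargeModuliFactorable.subwindow` — PROVED monotonicity corollary: any smaller level `x^θ`,
  `θ ≤ 1/2 + δ`, and any divisor window `(x^{lo}, x^{hi})` inside the printed one inherit the bound (a sub-sum
  of nonnegative terms);
* `MaynardLargeModuliFactorable.window_parity` — the instance `(δ, η) = (0.0101, 0.0098)`: moduli
  `q ≤ x^{0.5101}` coprime to `a` with a divisor in `(x^{3/100}, x^{19/250})`, requested by route
  `Parity/BarrierZoneCarving` (item `FactorableWindow`); the `π → ψ` partial summation, the `ψ*` boundary
  terms and the moduli not coprime to the shift are the route's business, not this file's.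

Design notes: the modulus range `q ≤ x^{1/2+δ}` is `Finset.Icc 1 ⌊x^{1/2+δ}⌋₊` (positive integers);
`x^{1/10}/x^{7δ/5+η} = x^{1/10 − 7δ/5 − η}` and `x^{1/2}/x^{19δ+η} = x^{1/2 − 19δ − η}` for `x > 0`; the
bound is rendered with explicit constants `∃ C x₀, ∀ x ≥ x₀, … ≤ C x/(log x)^A`, as in
`BombieriFriedlanderIwaniecTheorem10Pi`.  No `sorry`, no `instance`, no notation.
-/

noncomputable section

open Filter Finset

namespace Literature.NumberTheory.Sieve

/-! ### Corollary 1.2 as printed -/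

/-- **Maynard, *Primes in arithmetic progressions to large moduli I*, Corollary 1.2** (Mem. AMS 1542
(2025) = arXiv:2006.06572, §1): "Let `a ∈ ℤ`, `0 < δ < 1/42`, and `0 < η < (1 − 42δ)/4` and
`𝒬_{δ,η} := {q ≤ x^{1/2+δ} : ∃ d ∣ q s.t. x^{2δ+η} < d < min(x^{1/10}/x^{7δ/5+η}, x^{1/2}/x^{19δ+η})}`.
Then for every `A > 0` we have
`∑_{q ∈ 𝒬_{δ,η}, (q,a)=1} |π(x; q, a) − π(x)/φ(q)| ≪_{a,η,A} x/(log x)^A`."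
Rendered: for all such `a, δ, η, A` there are `C, x₀` with
`∑_{1 ≤ q ≤ x^{1/2+δ}, (q,a)=1, ∃ d ∣ q: x^{2δ+η} < d < min(x^{1/10−7δ/5−η}, x^{1/2−19δ−η})} |π(x; q, a) − π(x)/φ(q)|
≤ C x/(log x)^A` for all `x ≥ x₀`, where `π(x; q, a) = primeCountingMod q ((a : ZMod q).val) ⌊x⌋₊` and
`π(x) = Nat.primeCounting ⌊x⌋₊` (the constant may depend on `a, δ, η, A`; the print lists `a, η, A`).
A deep THEOREM ("primes are equidistributed for a fixed residue class over all moduli of size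
`x^{1/2+δ}` with a 'convenient sized' factor"; absolute values, beyond the `x^{1/2}` barrier); not in
Mathlib; vendored as a named fact. [cite: Maynard2020LargeModuliI, Corollary 1.2] -/
def MaynardLargeModuliFactorable : Prop :=
  ∀ a : ℤ, ∀ δ : ℝ, 0 < δ → δ < 1 / 42 → ∀ η : ℝ, 0 < η → η < (1 - 42 * δ) / 4 → ∀ A : ℝ, 0 < A →
    ∃ C x₀ : ℝ, ∀ x : ℝ, x₀ ≤ x →
      ∑ q ∈ (Icc 1 ⌊x ^ (1 / 2 + δ)⌋₊).filter (fun q : ℕ => IsCoprime (q : ℤ) a ∧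
          ∃ d ∈ Nat.divisors q, x ^ (2 * δ + η) < (d : ℝ) ∧
            (d : ℝ) < min (x ^ (1 / 10 - 7 * δ / 5 - η)) (x ^ (1 / 2 - 19 * δ - η))),
        |(LevelOfDistribution.primeCountingMod q (a : ZMod q).val ⌊x⌋₊ : ℝ) -
          (Nat.primeCounting ⌊x⌋₊ : ℝ) / Nat.totient q| ≤ C * x / Real.log x ^ A

/-- Unfolding `MaynardLargeModuliFactorable` at given `a, δ, η, A`, with the constant normalised to be
nonnegative and the threshold to be `≥ 2` (cosmetic). [cite: Maynard2020LargeModuliI, Corollary 1.2] -/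
theorem MaynardLargeModuliFactorable.bound_nonneg (h : MaynardLargeModuliFactorable) (a : ℤ) {δ : ℝ}
    (hδ : 0 < δ) (hδ' : δ < 1 / 42) {η : ℝ} (hη : 0 < η) (hη' : η < (1 - 42 * δ) / 4) {A : ℝ} (hA : 0 < A) :
    ∃ C x₀ : ℝ, 0 ≤ C ∧ 2 ≤ x₀ ∧ ∀ x : ℝ, x₀ ≤ x →
      ∑ q ∈ (Icc 1 ⌊x ^ (1 / 2 + δ)⌋₊).filter (fun q : ℕ => IsCoprime (q : ℤ) a ∧
          ∃ d ∈ Nat.divisors q, x ^ (2 * δ + η) < (d : ℝ) ∧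
            (d : ℝ) < min (x ^ (1 / 10 - 7 * δ / 5 - η)) (x ^ (1 / 2 - 19 * δ - η))),
        |(LevelOfDistribution.primeCountingMod q (a : ZMod q).val ⌊x⌋₊ : ℝ) -
          (Nat.primeCounting ⌊x⌋₊ : ℝ) / Nat.totient q| ≤ C * x / Real.log x ^ A := by
  obtain ⟨C, x₀, hC⟩ := h a δ hδ hδ' η hη hη' A hA
  refine ⟨max C 0, max x₀ 2, le_max_right _ _, le_max_right _ _, fun x hx => ?_⟩
  have hx₀ : x₀ ≤ x := (le_max_left _ _).trans hx
  have hx2 : 2 ≤ x := (le_max_right _ _).trans hx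
  refine (hC x hx₀).trans ?_
  have hlog : 0 < Real.log x := Real.log_pos (by linarith)
  gcongr
  · exact le_max_left _ _

/-! ### Proved corollaries: smaller windows, and the instance used by `Parity/BarrierZoneCarving` -/

/-- **Sub-windows inherit the bound** (PROVED from the fact; a sub-sum of nonnegative terms): for
`θ ≤ 1/2 + δ` and a divisor window `(x^{lo}, x^{hi})` with `2δ + η ≤ lo` and
`hi ≤ min(1/10 − 7δ/5 − η, 1/2 − 19δ − η)`, every modulus `q ≤ x^θ` coprime to `a` having a divisor in
`(x^{lo}, x^{hi})` lies in `𝒬_{δ,η}`, so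
`∑_{q ≤ x^θ, (q,a)=1, ∃ d ∣ q: x^{lo} < d < x^{hi}} |π(x; q, a) − π(x)/φ(q)| ≤ C x/(log x)^A` for `x ≥ x₀`.
[cite: Maynard2020LargeModuliI, Corollary 1.2] -/
theorem MaynardLargeModuliFactorable.subwindow (h : MaynardLargeModuliFactorable) (a : ℤ) {δ η lo hi θ : ℝ}
    (hδ : 0 < δ) (hδ' : δ < 1 / 42) (hη : 0 < η) (hη' : η < (1 - 42 * δ) / 4)
    (hlo : 2 * δ + η ≤ lo) (hhi : hi ≤ 1 / 10 - 7 * δ / 5 - η) (hhi' : hi ≤ 1 / 2 - 19 * δ - η)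
    (hθ : θ ≤ 1 / 2 + δ) {A : ℝ} (hA : 0 < A) :
    ∃ C x₀ : ℝ, 0 ≤ C ∧ 2 ≤ x₀ ∧ ∀ x : ℝ, x₀ ≤ x →
      ∑ q ∈ (Icc 1 ⌊x ^ θ⌋₊).filter (fun q : ℕ => IsCoprime (q : ℤ) a ∧
          ∃ d ∈ Nat.divisors q, x ^ lo < (d : ℝ) ∧ (d : ℝ) < x ^ hi),
        |(LevelOfDistribution.primeCountingMod q (a : ZMod q).val ⌊x⌋₊ : ℝ) -
          (Nat.primeCounting ⌊x⌋₊ : ℝ) / Nat.totient q| ≤ C * x / Real.log x ^ A := by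
  obtain ⟨C, x₀, hC0, hx₀2, hC⟩ := h.bound_nonneg a hδ hδ' hη hη' hA
  refine ⟨C, x₀, hC0, hx₀2, fun x hx => le_trans ?_ (hC x hx)⟩
  have hx1 : (1 : ℝ) ≤ x := by linarith [hx₀2.trans hx]
  refine Finset.sum_le_sum_of_subset_of_nonneg ?_ fun _ _ _ => abs_nonneg _
  intro q hq
  simp only [Finset.mem_filter, Finset.mem_Icc] at hq ⊢
  obtain ⟨⟨hq1, hqθ⟩, hcop, d, hd, hdlo, hdhi⟩ := hq
  refine ⟨⟨hq1, hqθ.trans (Nat.floor_le_floor (Real.rpow_le_rpow_of_exponent_le hx1 hθ))⟩, hcop, d, hd,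
    lt_of_le_of_lt (Real.rpow_le_rpow_of_exponent_le hx1 hlo) hdlo, lt_of_lt_of_le hdhi (le_min ?_ ?_)⟩
  · exact Real.rpow_le_rpow_of_exponent_le hx1 hhi
  · exact Real.rpow_le_rpow_of_exponent_le hx1 hhi'

/-- **The window of route `Parity/BarrierZoneCarving`** (PROVED instance of Corollary 1.2 at
`(δ, η) = (101/10000, 98/10000)`: `2δ + η = 3/100`, `1/10 − 7δ/5 − η = 0.07606 ≥ 19/250 = 0.076`,
`1/2 − 19δ − η = 0.2983`, `δ < 1/42`, `η < (1 − 42δ)/4 = 0.14395`): for every `a ∈ ℤ` and `A > 0` there are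
`C ≥ 0`, `x₀ ≥ 2` with
`∑_{q ≤ x^{0.5101}, (q,a)=1, ∃ d ∣ q: x^{3/100} < d < x^{19/250}} |π(x; q, a) − π(x)/φ(q)| ≤ C x/(log x)^A`
for all `x ≥ x₀`. [cite: Maynard2020LargeModuliI, Corollary 1.2] -/
theorem MaynardLargeModuliFactorable.window_parity (h : MaynardLargeModuliFactorable) (a : ℤ) {A : ℝ}
    (hA : 0 < A) :
    ∃ C x₀ : ℝ, 0 ≤ C ∧ 2 ≤ x₀ ∧ ∀ x : ℝ, x₀ ≤ x →
      ∑ q ∈ (Icc 1 ⌊x ^ (5101 / 10000 : ℝ)⌋₊).filter (fun q : ℕ => IsCoprime (q : ℤ) a ∧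
          ∃ d ∈ Nat.divisors q, x ^ (3 / 100 : ℝ) < (d : ℝ) ∧ (d : ℝ) < x ^ (19 / 250 : ℝ)),
        |(LevelOfDistribution.primeCountingMod q (a : ZMod q).val ⌊x⌋₊ : ℝ) -
          (Nat.primeCounting ⌊x⌋₊ : ℝ) / Nat.totient q| ≤ C * x / Real.log x ^ A :=
  h.subwindow a (δ := 101 / 10000) (η := 98 / 10000) (by norm_num) (by norm_num) (by norm_num)
    (by norm_num) (by norm_num) (by norm_num) (by norm_num) (by norm_num) hA

end Literature.NumberTheory.Sieve

end
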